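import Summits.KontsevichZagierPeriods.KontsevichZagierPeriods.Theorems.PlanarCompiler.Negative.GreenTightness

/-!
# `PlanarCompiler` (stmt-KontsevichZagierPeriods-10058) — negative side II′: the orientation of the
Green generator is typed exactly right

Companion to `Negative/GreenTightness.lean`. The three edge terms of the inlined Green generator of
the antecedent (`RealOnePeriodRelations`) carry the counter-clockwise orientation of `∂Δ`:
`+[∫A(t,0)]`, `+[∫(B − A)(1−t,t)]`, `−[∫B(0,t)]`. Both natural slips are UNSOUND already for the
exact form `η = db` (`A = 0`, `B = 1`, `S = b`): the left-edge sign slip (`greenLeftSignSlip_unsound`,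
eval `2`) and the hypotenuse orientation slip (`greenHypotenuseSlip_unsound`, eval `−2`), while the
typed combination evaluates to `0` on the same datum (`green_typed_db_sound`). Provers may trust the
typed signs; the transfer `CurvePeriodsTransfer` must orient its semialgebraic triangles accordingly.
[Kontsevich–Zagier 2001, §1.2]
-/

noncomputable section

open MeasureTheory Set MvPolynomial
open Literature.NumberTheory.Transcendental Literature.ModelTheory.ExponentialFields

namespace Summit.KontsevichZagierPeriods.SymplecticScissors.PlanarCompilerNegative

/-! ### §4.2 Orientation of the Green generator is typed exactly right (slip checks)

The three edge terms carry the counter-clockwise orientation of `∂Δ`: `+[∫A(t,0)]` (bottom edge),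
`+[∫(B − A)(1−t,t)]` (hypotenuse, `da = −dt`, `db = dt`), `−[∫B(0,t)]` (left edge, traversed
downwards). Each of the two natural slips is UNSOUND already for the exact form `η = db`
(`A = 0`, `B = 1`, `S = b`): sign slip on the left edge (`… + [∫B(0,t)]`, eval `2`) and orientation
slip on the hypotenuse (`[∫(A − B)(1−t,t)]`, eval `−2`). So a prover may trust the typed signs, and
the transfer (CurvePeriodsTransfer) must orient its semialgebraic triangles accordingly. -/

/-- The constant-`1` representation on `(0,1)`. [folklore] -/
def oneRep : KZ.IntegralRep 1 where
  domain := unitIoo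
  integrand := fun _ => 1
  isSemialgebraic_domain := isSemialgebraic_unitIoo
  isSemialgebraicFunOn_integrand := by
    simpa using isSemialgebraicFunOn_aeval isSemialgebraic_unitIoo (C 1 : MvPolynomial (Fin 1) ℚ)
  integrableOn := integrableOn_const volume_unitIoo_lt_top.ne

/-- Auxiliary: `value_oneRep`. [folklore] -/
@[simp] theorem value_oneRep : oneRep.value = 1 := by
  rw [KZ.IntegralRep.value, show oneRep.integrand = fun _ => (1 : ℝ) from rfl, setIntegral_const,
    smul_eq_mul, mul_one, measureReal_def, show oneRep.domain = unitIoo from rfl, volume_unitIoo_toReal]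

/-- The potential `S = b` (exact form `db`): `A = 0`, `B = 1`. [folklore] -/
theorem hasFDerivAt_snd (p : Fin 2 → ℝ) :
    HasFDerivAt (fun q : Fin 2 → ℝ => q 1)
      ((0 : ℝ) • ContinuousLinearMap.proj (R := ℝ) (φ := fun _ : Fin 2 => ℝ) 0 +
        (1 : ℝ) • ContinuousLinearMap.proj (R := ℝ) (φ := fun _ : Fin 2 => ℝ) 1) p := by
  have h := hasFDerivAt_apply (𝕜 := ℝ) 1 p
  refine h.congr_fderiv ?_
  ext v
  simp

/-- Green data predicate shared by the slip variants (everything as typed in the crux; a hypothesis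
bundle stated only to be instantiated by the two refuted slips below). -/
def IsGreenData (A B S : (Fin 2 → ℝ) → ℝ) (r₀₁ r₁₂' r₀₂ : KZ.IntegralRep 1)
    (hyp : (Fin 2 → ℝ) → ℝ) : Prop :=
  IsSemialgebraicFunOn ℚ triangle A ∧ IsSemialgebraicFunOn ℚ triangle B ∧
    ContinuousOn A triangle ∧ ContinuousOn B triangle ∧
    (∀ p : Fin 2 → ℝ, 0 < p 0 → 0 < p 1 → p 0 + p 1 < 1 →
      HasFDerivAt S (A p • ContinuousLinearMap.proj (R := ℝ) (φ := fun _ : Fin 2 => ℝ) 0 +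
        B p • ContinuousLinearMap.proj (R := ℝ) (φ := fun _ : Fin 2 => ℝ) 1) p) ∧
    r₀₁.domain = {z | z 0 ∈ Set.Ioo 0 1} ∧ r₁₂'.domain = {z | z 0 ∈ Set.Ioo 0 1} ∧
    r₀₂.domain = {z | z 0 ∈ Set.Ioo 0 1} ∧
    (∀ z ∈ r₀₁.domain, r₀₁.integrand z = A ![z 0, 0]) ∧
    (∀ z ∈ r₁₂'.domain, r₁₂'.integrand z = hyp ![1 - z 0, z 0]) ∧
    (∀ z ∈ r₀₂.domain, r₀₂.integrand z = B ![0, z 0])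

/-- SLIP 1 (sign of the left edge): `g = [r₀₁] + [r₁₂] + [r₀₂]` with the typed hypotenuse `B − A`. [folklore] -/
def greenLeftSignSlip : Set KZ.FormalRep :=
  {g | ∃ (A B S : (Fin 2 → ℝ) → ℝ) (r₀₁ r₁₂ r₀₂ : KZ.IntegralRep 1),
    IsGreenData A B S r₀₁ r₁₂ r₀₂ (fun p => B p - A p) ∧ g = KZ.of r₀₁ + KZ.of r₁₂ + KZ.of r₀₂}

/-- SLIP 2 (orientation of the hypotenuse): integrand `(A − B)(1−t,t)`, typed signs elsewhere. [folklore] -/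
def greenHypotenuseSlip : Set KZ.FormalRep :=
  {g | ∃ (A B S : (Fin 2 → ℝ) → ℝ) (r₀₁ r₁₂ r₀₂ : KZ.IntegralRep 1),
    IsGreenData A B S r₀₁ r₁₂ r₀₂ (fun p => A p - B p) ∧ g = KZ.of r₀₁ + KZ.of r₁₂ - KZ.of r₀₂}

/-- Auxiliary: `isGreenData_db`. [folklore] -/
theorem isGreenData_db (hyp : (Fin 2 → ℝ) → ℝ) (r : KZ.IntegralRep 1) (hr : r.domain = unitIoo)
    (hint : ∀ z ∈ r.domain, r.integrand z = hyp ![1 - z 0, z 0]) :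
    IsGreenData (fun _ => 0) (fun _ => 1) (fun q => q 1) zeroRep r oneRep hyp := by
  refine ⟨?_, ?_, continuousOn_const, continuousOn_const, fun p _ _ _ => hasFDerivAt_snd p,
    rfl, hr, rfl, fun _ _ => rfl, hint, fun _ _ => rfl⟩
  · simpa using isSemialgebraicFunOn_aeval isSemialgebraic_triangle (C 0 : MvPolynomial (Fin 2) ℚ)
  · simpa using isSemialgebraicFunOn_aeval isSemialgebraic_triangle (C 1 : MvPolynomial (Fin 2) ℚ)

/-- The left-edge sign slip is UNSOUND: `η = db` gives eval `0 + 1 + 1 = 2`. [folklore] -/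
theorem greenLeftSignSlip_unsound : ∃ g ∈ greenLeftSignSlip, KZ.eval g ≠ 0 := by
  refine ⟨KZ.of zeroRep + KZ.of oneRep + KZ.of oneRep, ⟨fun _ => 0, fun _ => 1, fun q => q 1,
    zeroRep, oneRep, oneRep, isGreenData_db _ oneRep rfl (fun _ _ => by simp [oneRep]), rfl⟩, ?_⟩
  rw [map_add, map_add, KZ.eval_of, KZ.eval_of, value_zeroRep, value_oneRep]
  norm_num

/-- The constant `−1` representation on `(0,1)`. [folklore] -/
def negOneRep : KZ.IntegralRep 1 where
  domain := unitIoo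
  integrand := fun _ => -1
  isSemialgebraic_domain := isSemialgebraic_unitIoo
  isSemialgebraicFunOn_integrand := by
    simpa using isSemialgebraicFunOn_aeval isSemialgebraic_unitIoo (C (-1) : MvPolynomial (Fin 1) ℚ)
  integrableOn := integrableOn_const volume_unitIoo_lt_top.ne

/-- Auxiliary: `value_negOneRep`. [folklore] -/
@[simp] theorem value_negOneRep : negOneRep.value = -1 := by
  rw [KZ.IntegralRep.value, show negOneRep.integrand = fun _ => (-1 : ℝ) from rfl, setIntegral_const,
    smul_eq_mul, measureReal_def, show negOneRep.domain = unitIoo from rfl, volume_unitIoo_toReal]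
  norm_num

/-- The hypotenuse orientation slip is UNSOUND: `η = db` gives eval `0 + (−1) − 1 = −2`. [folklore] -/
theorem greenHypotenuseSlip_unsound : ∃ g ∈ greenHypotenuseSlip, KZ.eval g ≠ 0 := by
  refine ⟨KZ.of zeroRep + KZ.of negOneRep - KZ.of oneRep, ⟨fun _ => 0, fun _ => 1, fun q => q 1,
    zeroRep, negOneRep, oneRep, isGreenData_db _ negOneRep rfl (fun _ _ => by simp [negOneRep]),
    rfl⟩, ?_⟩
  rw [map_sub, map_add, KZ.eval_of, KZ.eval_of, KZ.eval_of, value_zeroRep, value_negOneRep,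
    value_oneRep]
  norm_num

/-- SANITY (the typed orientation is sound on this datum): `0 + 1 − 1 = 0`. [folklore] -/
theorem green_typed_db_sound :
    KZ.eval (KZ.of zeroRep + KZ.of oneRep - KZ.of oneRep) = 0 := by
  rw [map_sub, map_add, KZ.eval_of, KZ.eval_of, value_zeroRep, value_oneRep]
  norm_num

end Summit.KontsevichZagierPeriods.SymplecticScissors.PlanarCompilerNegative
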